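import Summits.CriticalPhenomena.Ising3D.ExclusionSentencesControl2D
import Summits.CriticalPhenomena.Ising3D.ExclusionSentencesControl2DC
import Summits.CriticalPhenomena.Ising3D.ExclusionSentencesControl2DAlg
import Summits.CriticalPhenomena.Ising3D.ExclusionSentencesControl2DKacxFull
import Summits.CriticalPhenomena.Ising3D.ExclusionSentencesControl2DZeta
import Summits.CriticalPhenomena.Ising3D.ExclusionSentencesControl2DZetaEps
import Summits.CriticalPhenomena.Ising3D.ExclusionSentencesControl2DTrgGammaFin
import Summits.CriticalPhenomena.Ising3D.ExclusionSentencesControl2DTrgGammaEpsFin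
import Summits.CriticalPhenomena.Ising3D.ExclusionSentencesControl2DTrgGammaSigma8Fin
import Summits.CriticalPhenomena.Ising3D.ExclusionSentencesControl2DTrgGammaEps6Fin

/-!
# Exclusion sentences — the 2D control RECOGNISED in the kernel, against the whole frozen catalogue
(cell `pub-ising3x`, seat recog-1, gen 6)

HONEST FRAMING: lottery ticket; floor = tightest certified 3D Ising CFT bounds; no exact-solution
claim without a proof.

SCOPE.md §4 asks of the 2D control: "from certified 2D bootstrap digits ALONE the pipeline must recognise
Onsager/BPZ exact data (`Δ_σ = 1/8`, `Δ_ε = 1`) — report at which certified precision each is recognised".  The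
frozen recogniser answered it blind (round R2: PASS at 6 certified digits under the protocol's rule C, §3.7/§4).
Gens 3–5 landed one kernel sentence PER FAMILY of FAMILIES-v1.  This file assembles them into the two statements
a referee reads, quantifying over the ENTIRE frozen catalogue of kind `Delta` at its table bounds —
`RAT` (denominator `≤ 10⁶` = the recogniser's report bound `Q_report`, resp. `≤ 10⁵`), `KAC` (`p′ ≤ 24`,
`n ≤ 8`), `KACX` (all four sub-tables), `ALG` (every degree `d ≤ 6` at its table height `H_d`), `LIN` (`H ≤ 12`,
all seven constants), `TRG` (the whole table, `D ≤ 17`, `h ≤ 32`, `Γ` powers included) and the `NAMED` lists: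

* `control2D_sigma_catalogue` — at the blind width `10⁻⁶` the catalogue members near `Δ_σ = 1/8` are EXACTLY:
  `1/8` (RAT/KAC/KACX/ALG), the nine LIN values `controlSigmaLinEx` and the four TRG monomials
  `controlSigmaTrgGEx` (thirteen transcendental near-misses = the exclusion data that fail rule R2);
* `control2D_sigma_recognised` — at `10⁻⁸` (two rungs later) the ONLY catalogue member is `1/8`:
  **`Δ_σ^{2D}` is recognised as `1/8` by the kernel at 8 certified digits** (not at 7: the LIN member
  `(98 − 3π³ − 3ζ(3))/11` lies within `7·10⁻⁸`);
* `control2D_eps_recognised` — at `10⁻⁶` the ONLY catalogue member near `Δ_ε = 1` is `1`: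
  **`Δ_ε^{2D}` is recognised as `1` at 6 certified digits** (at `10⁻⁵`: six LIN and five TRG near-misses,
  `control_eps_trg_lin`, `control_eps_trgFull`);
* non-vacuity of the positive side: `1/8` and `1` ARE catalogue members (`one_eighth_mem_kacFamily`,
  `one_mem_kacFamily` of `ExclusionSentences.lean`), restated in the hypothesis shape used here.

The pair families `KACJ ⊂ KAC × KAC`, `NAMEDJ` (= `namedPairs`) project onto the lists above, and `CLASSIC` is `RAT`
applied to the derived exponents `β = Δ_σ/(d − Δ_ε)`, `γ = (d − 2Δ_σ)/(d − Δ_ε)` (`ExclusionSentencesClassic.lean`),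
so no single-datum member is missed.  The statistics of §3.4 (false-match model, rule R2) stay a protocol; these
theorems are its rule-R1/R3 content.  Elementary rational lemma `rat_eq_of_den_le_of_abs_sub_lt` (two distinct
rationals `r ≠ s` satisfy `|r − s| ≥ 1/(r.den · s.den)`).  No 3D digit is used anywhere.
-/

namespace Summit.CriticalPhenomena.Ising3D

/-! ### Rationals: a bounded-denominator rational close to `s` is `s` -/

/-- Two distinct rationals are at least `1/(r.den · s.den)` apart; hence a rational `r` with `r.den ≤ Q` and
`|r − s| < 1/(s.den · Q)` equals `s`.  Elementary. -/
theorem rat_eq_of_den_le_of_abs_sub_lt {r s : ℚ} {Q : ℕ} (hQ : r.den ≤ Q)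
    (h : |r - s| < 1 / ((s.den : ℚ) * Q)) : r = s := by
  by_contra hne
  have hrd : (0 : ℚ) < r.den := by exact_mod_cast r.den_pos
  have hsd : (0 : ℚ) < s.den := by exact_mod_cast s.den_pos
  have hQpos : (0 : ℚ) < Q := lt_of_lt_of_le hrd (by exact_mod_cast hQ)
  -- `(r - s) · r.den · s.den` is the integer `N = r.num · s.den − s.num · r.den`
  set N : ℤ := r.num * s.den - s.num * r.den with hN
  have hkey : (r - s) * ((r.den : ℚ) * s.den) = (N : ℚ) := by
    have hr := Rat.mul_den_eq_num r
    have hs := Rat.mul_den_eq_num s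
    simp only [hN, Int.cast_sub, Int.cast_mul, Int.cast_natCast]
    calc (r - s) * ((r.den : ℚ) * s.den) = r * r.den * s.den - s * s.den * r.den := by ring
      _ = (r.num : ℚ) * s.den - (s.num : ℚ) * r.den := by rw [hr, hs]
  have hN0 : N ≠ 0 := by
    intro h0
    rw [h0, Int.cast_zero, mul_eq_zero] at hkey
    rcases hkey with h1 | h1
    · exact hne (sub_eq_zero.mp h1)
    · exact absurd h1 (by positivity)
  have hN1 : (1 : ℚ) ≤ |(N : ℚ)| := by
    rw [← Int.cast_abs]
    exact_mod_cast Int.one_le_abs hN0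
  -- so `|r - s| ≥ 1/(r.den · s.den) ≥ 1/(Q · s.den)`
  have habs : |r - s| * ((r.den : ℚ) * s.den) = |(N : ℚ)| := by
    rw [← hkey, abs_mul, abs_of_pos (by positivity : (0 : ℚ) < (r.den : ℚ) * s.den)]
  have hge : 1 / ((s.den : ℚ) * Q) ≤ |r - s| := by
    rw [div_le_iff₀ (by positivity)]
    have hmono : |r - s| * ((r.den : ℚ) * s.den) ≤ |r - s| * ((s.den : ℚ) * Q) := by
      apply mul_le_mul_of_nonneg_left _ (abs_nonneg _)
      calc (r.den : ℚ) * s.den = (s.den : ℚ) * r.den := by ring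
        _ ≤ (s.den : ℚ) * Q := by
          apply mul_le_mul_of_nonneg_left _ hsd.le
          exact_mod_cast hQ
    linarith
  exact absurd h (not_lt.mpr hge)

/-- A rational of denominator `≤ 10⁶` within `10⁻⁸` of `1/8` (as a real) IS `1/8`
(`|r − 1/8| ≥ 1/(8 · r.den) ≥ 1.25·10⁻⁷` otherwise). -/
theorem control_sigma8_rat_unique {x : ℝ}
    (hx : ((1 / 8 - 1 / 10 ^ 8 : ℚ) : ℝ) ≤ x ∧ x ≤ ((1 / 8 + 1 / 10 ^ 8 : ℚ) : ℝ)) (r : ℚ) (hden : r.den ≤ 10 ^ 6)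
    (hxr : x = (r : ℝ)) : r = 1 / 8 := by
  subst hxr
  have h1 : (1 / 8 - 1 / 10 ^ 8 : ℚ) ≤ r := by exact_mod_cast hx.1
  have h2 : r ≤ (1 / 8 + 1 / 10 ^ 8 : ℚ) := by exact_mod_cast hx.2
  refine rat_eq_of_den_le_of_abs_sub_lt hden ?_
  have hd : (1 / 8 : ℚ).den = 8 := by decide +kernel
  rw [hd, abs_sub_lt_iff]
  push_cast
  constructor <;> linarith

/-- A rational of denominator `≤ 10⁵` within `10⁻⁶` of `1/8` IS `1/8`. -/
theorem control_sigma6_rat_unique {x : ℝ}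
    (hx : ((1 / 8 - 1 / 10 ^ 6 : ℚ) : ℝ) ≤ x ∧ x ≤ ((1 / 8 + 1 / 10 ^ 6 : ℚ) : ℝ)) (r : ℚ) (hden : r.den ≤ 10 ^ 5)
    (hxr : x = (r : ℝ)) : r = 1 / 8 := by
  subst hxr
  have h1 : (1 / 8 - 1 / 10 ^ 6 : ℚ) ≤ r := by exact_mod_cast hx.1
  have h2 : r ≤ (1 / 8 + 1 / 10 ^ 6 : ℚ) := by exact_mod_cast hx.2
  refine rat_eq_of_den_le_of_abs_sub_lt hden ?_
  have hd : (1 / 8 : ℚ).den = 8 := by decide +kernel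
  rw [hd, abs_sub_lt_iff]
  push_cast
  constructor <;> linarith

/-- A rational of denominator `≤ 10⁵` within `10⁻⁶` of `1` IS `1`. -/
theorem control_eps6_rat_unique {x : ℝ}
    (hx : ((1 - 1 / 10 ^ 6 : ℚ) : ℝ) ≤ x ∧ x ≤ ((1 + 1 / 10 ^ 6 : ℚ) : ℝ)) (r : ℚ) (hden : r.den ≤ 10 ^ 5)
    (hxr : x = (r : ℝ)) : r = 1 := by
  subst hxr
  have h1 : (1 - 1 / 10 ^ 6 : ℚ) ≤ r := by exact_mod_cast hx.1
  have h2 : r ≤ (1 + 1 / 10 ^ 6 : ℚ) := by exact_mod_cast hx.2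
  refine rat_eq_of_den_le_of_abs_sub_lt hden ?_
  have hd : (1 : ℚ).den = 1 := by rfl
  rw [hd, abs_sub_lt_iff]
  push_cast
  constructor <;> linarith

/-! ### The `NAMED` lists are far from the 2D values -/

/-- No `NAMED` value (`namedSigma`, `namedEps`: projections of the published 3D proposals) lies within `10⁻⁶` of
`1/8`. -/
theorem control_sigma6_not_named {x : ℝ}
    (hx : ((1 / 8 - 1 / 10 ^ 6 : ℚ) : ℝ) ≤ x ∧ x ≤ ((1 / 8 + 1 / 10 ^ 6 : ℚ) : ℝ)) (v : ℚ)
    (hv : v ∈ namedSigma ∨ v ∈ namedEps) : x ≠ (v : ℝ) := by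
  rintro rfl
  have h1 : (1 / 8 - 1 / 10 ^ 6 : ℚ) ≤ v := by exact_mod_cast hx.1
  have h2 : v ≤ (1 / 8 + 1 / 10 ^ 6 : ℚ) := by exact_mod_cast hx.2
  have key : ∀ w ∈ namedSigma ++ namedEps, (1 / 8 + 1 / 10 ^ 6 : ℚ) < w := by decide +kernel
  have := key v (by simpa [List.mem_append] using hv)
  linarith

/-- No `NAMED` value lies within `10⁻⁶` of `1`. -/
theorem control_eps6_not_named {x : ℝ}
    (hx : ((1 - 1 / 10 ^ 6 : ℚ) : ℝ) ≤ x ∧ x ≤ ((1 + 1 / 10 ^ 6 : ℚ) : ℝ)) (v : ℚ)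
    (hv : v ∈ namedSigma ∨ v ∈ namedEps) : x ≠ (v : ℝ) := by
  rintro rfl
  have h1 : (1 - 1 / 10 ^ 6 : ℚ) ≤ v := by exact_mod_cast hx.1
  have h2 : v ≤ (1 + 1 / 10 ^ 6 : ℚ) := by exact_mod_cast hx.2
  have key : ∀ w ∈ namedSigma ++ namedEps, w < (1 - 1 / 10 ^ 6 : ℚ) ∨ (1 + 1 / 10 ^ 6 : ℚ) < w := by
    decide +kernel
  rcases key v (by simpa [List.mem_append] using hv) with h | h <;> linarith

/-! ### `Δ_σ = 1/8`: the catalogue at the blind width, and recognition two rungs later -/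

/-- **The frozen catalogue near `Δ_σ = 1/8` at the blind width `10⁻⁶`, complete, in the kernel.**  A real within
`10⁻⁶` of `1/8` that is a member of any FAMILIES-v1 family (kind `Delta`, table bounds; `RAT` cut at denominator
`10⁵`) is: `1/8` itself (if rational / Kac / KACX / algebraic of degree `≤ 6`), or one of the nine listed LIN values
`controlSigmaLinEx` (on `3(π³ + ζ(3)) ≈ 96.625`, `8 log 2 + 5G ≈ 10.125`), or one of the four listed TRG monomials
`controlSigmaTrgGEx`; and it is no `NAMED` value. -/
theorem control2D_sigma_catalogue {x : ℝ}
    (hx : ((1 / 8 - 1 / 10 ^ 6 : ℚ) : ℝ) ≤ x ∧ x ≤ ((1 / 8 + 1 / 10 ^ 6 : ℚ) : ℝ)) :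
    (∀ r : ℚ, r.den ≤ 10 ^ 5 → x = (r : ℝ) → r = 1 / 8) ∧
    (∀ v ∈ kacFamily 24 8, x = (v : ℝ) → v = 1 / 8) ∧
    (∀ v ∈ kacxFamily, x = (v : ℝ) → v = 1 / 8) ∧
    (∀ d H : ℕ, (d, H) ∈ algTable → x ∈ algFamily d H → x = 1 / 8) ∧
    (x ∈ linFamily 12 → ∃ e ∈ controlSigmaLinEx, x = lin7TupleVal e) ∧
    (x ∈ trgFullFamily 17 32 → ∃ e ∈ controlSigmaTrgGEx, x = trgGTupleVal e) ∧
    (∀ v : ℚ, v ∈ namedSigma ∨ v ∈ namedEps → x ≠ (v : ℝ)) :=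
  ⟨fun r hden hxr => control_sigma6_rat_unique hx r hden hxr,
    fun v hv hxv => control_sigma_kac_unique hx v hv hxv,
    fun v hv hxv => control_sigma_kacx_unique hx v hv hxv,
    fun _ _ hdH hmem => control_sigma_alg_unique hx hdH hmem,
    fun hm => (control_sigma_trg_lin hx).2.1 hm,
    fun hm => control_sigma_trgFull hx hm,
    fun v hv => control_sigma6_not_named hx v hv⟩

/-- **`Δ_σ^{2D} = 1/8` RECOGNISED in the kernel at 8 certified digits.**  A real within `10⁻⁸` of `1/8` that is a
member of ANY family of the frozen catalogue FAMILIES-v1 (kind `Delta`) at the table bounds — a rational of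
denominator `≤ 10⁶`, a Virasoro Kac value (`p′ ≤ 24`, `n ≤ 8`), a KACX value (`N = 1`, `W₃`, `SU(2)_k`, `ℤ_k`
tables), a real algebraic number of degree `d ≤ 6` and height `≤ H_d`, a LIN form of height `≤ 12` in
`π, π², π³, log 2, ζ(3), ζ(5), G`, a TRG monomial (`D ≤ 17`, `h ≤ 32`, with `Γ(¼)`, `Γ(⅓)` powers), or a `NAMED`
value — IS `1/8`.  (The LIN and TRG disjuncts are vacuous at this width: no member at all.) -/
theorem control2D_sigma_recognised {x : ℝ}
    (hx : ((1 / 8 - 1 / 10 ^ 8 : ℚ) : ℝ) ≤ x ∧ x ≤ ((1 / 8 + 1 / 10 ^ 8 : ℚ) : ℝ))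
    (hcat : (∃ r : ℚ, r.den ≤ 10 ^ 6 ∧ x = (r : ℝ)) ∨ (∃ v ∈ kacFamily 24 8, x = (v : ℝ)) ∨
      (∃ v ∈ kacxFamily, x = (v : ℝ)) ∨ (∃ d H : ℕ, (d, H) ∈ algTable ∧ x ∈ algFamily d H) ∨
      x ∈ linFamily 12 ∨ x ∈ trgFullFamily 17 32 ∨ (∃ v : ℚ, (v ∈ namedSigma ∨ v ∈ namedEps) ∧ x = (v : ℝ))) :
    x = 1 / 8 := by
  have hx6 : ((1 / 8 - 1 / 10 ^ 6 : ℚ) : ℝ) ≤ x ∧ x ≤ ((1 / 8 + 1 / 10 ^ 6 : ℚ) : ℝ) := by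
    obtain ⟨h1, h2⟩ := hx
    push_cast at h1 h2 ⊢
    constructor <;> linarith
  rcases hcat with ⟨r, hden, hxr⟩ | ⟨v, hv, hxv⟩ | ⟨v, hv, hxv⟩ | ⟨d, H, hdH, hmem⟩ | hm | hm | ⟨v, hv, hxv⟩
  · rw [hxr, control_sigma8_rat_unique hx r hden hxr]; push_cast; ring
  · rw [hxv, control_sigma_kac_unique hx6 v hv hxv]; push_cast; ring
  · rw [hxv, control_sigma_kacx_unique hx6 v hv hxv]; push_cast; ring
  · exact control_sigma_alg_unique hx6 hdH hmem
  · exact absurd hm ((control_sigma_trg_lin hx6).2.2 hx)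
  · exact absurd hm (control_sigma8_not_trgFull hx)
  · exact absurd hxv (control_sigma6_not_named hx6 v hv)

/-- Non-vacuity of the positive side: `1/8` itself is a catalogue member in the hypothesis shape of
`control2D_sigma_recognised` (a rational of denominator `8`, and the Kac value `2h_{1,2}(M(3,4))`). -/
theorem control2D_sigma_recognised_nonvacuous :
    (∃ r : ℚ, r.den ≤ 10 ^ 6 ∧ ((1 : ℝ) / 8) = (r : ℝ)) ∧ (∃ v ∈ kacFamily 24 8, ((1 : ℝ) / 8) = (v : ℝ)) :=
  ⟨⟨1 / 8, by decide +kernel, by push_cast; ring⟩, ⟨1 / 8, one_eighth_mem_kacFamily, by push_cast; ring⟩⟩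

/-! ### `Δ_ε = 1`: recognition one rung after the blind width -/

/-- **`Δ_ε^{2D} = 1` RECOGNISED in the kernel at 6 certified digits.**  A real within `10⁻⁶` of `1` that is a member
of ANY family of the frozen catalogue (kind `Delta`, table bounds; `RAT` cut at denominator `10⁵`) IS `1`.
(At the blind width `10⁻⁵` the LIN table has six members and the TRG table five near `1` — `control_eps_trg_lin`,
`control_eps_trgFull` — all gone at `10⁻⁶`: `control_eps6_not_trgFull`.) -/
theorem control2D_eps_recognised {x : ℝ}
    (hx : ((1 - 1 / 10 ^ 6 : ℚ) : ℝ) ≤ x ∧ x ≤ ((1 + 1 / 10 ^ 6 : ℚ) : ℝ))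
    (hcat : (∃ r : ℚ, r.den ≤ 10 ^ 5 ∧ x = (r : ℝ)) ∨ (∃ v ∈ kacFamily 24 8, x = (v : ℝ)) ∨
      (∃ v ∈ kacxFamily, x = (v : ℝ)) ∨ (∃ d H : ℕ, (d, H) ∈ algTable ∧ x ∈ algFamily d H) ∨
      x ∈ linFamily 12 ∨ x ∈ trgFullFamily 17 32 ∨ (∃ v : ℚ, (v ∈ namedSigma ∨ v ∈ namedEps) ∧ x = (v : ℝ))) :
    x = 1 := by
  have hx5 : ((1 - 1 / 10 ^ 5 : ℚ) : ℝ) ≤ x ∧ x ≤ ((1 + 1 / 10 ^ 5 : ℚ) : ℝ) := by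
    obtain ⟨h1, h2⟩ := hx
    push_cast at h1 h2 ⊢
    constructor <;> linarith
  rcases hcat with ⟨r, hden, hxr⟩ | ⟨v, hv, hxv⟩ | ⟨v, hv, hxv⟩ | ⟨d, H, hdH, hmem⟩ | hm | hm | ⟨v, hv, hxv⟩
  · rw [hxr, control_eps6_rat_unique hx r hden hxr]; push_cast; ring
  · have hv1 : v = 1 := by
      by_contra hne
      exact ne_kac_of_kacExcluded kacExcluded_control_eps hx5 v hv (by simpa using hne) hxv
    rw [hxv, hv1]; push_cast; ring
  · rw [hxv, control_eps_kacx_unique hx5 v hv hxv]; push_cast; ring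
  · exact control_eps_alg_unique hx5 hdH hmem
  · exact absurd hm ((control_eps_trg_lin hx5).2.2 hx)
  · exact absurd hm (control_eps6_not_trgFull hx)
  · exact absurd hxv (control_eps6_not_named hx v hv)

/-- Non-vacuity of the positive side: `1` itself is a catalogue member in the hypothesis shape of
`control2D_eps_recognised` (the rational `1`, and the Kac value `2h_{2,1}(M(3,4))`). -/
theorem control2D_eps_recognised_nonvacuous :
    (∃ r : ℚ, r.den ≤ 10 ^ 5 ∧ (1 : ℝ) = (r : ℝ)) ∧ (∃ v ∈ kacFamily 24 8, (1 : ℝ) = (v : ℝ)) :=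
  ⟨⟨1, by decide, by push_cast; ring⟩, ⟨1, one_mem_kacFamily, by push_cast; ring⟩⟩

end Summit.CriticalPhenomena.Ising3D
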